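import Summits.QuantumFields.YangMills.Theorems.LuscherReductionOneSiteLevelsNormaliser
import Summits.QuantumFields.YangMills.Theorems.LuscherReductionRunningReductionLatticeTopLower
import HarnessLib

/-!
# The one-link window mass `m_β(r) = ∫_{‖W−1‖_F ≤ r} e^{β Re tr W} dW` is β-UNIFORMLY comparable to the normaliser `c_β` at the natural
# radius `r = a/√β` (sub-stub C4-low₀ of the fixed-lattice programme COARSE(L₀) — route `LuscherReduction`, crux RED stmt-QuantumFields-19978
# KT-door 3b′ / crux `TwistedTraceScaling` stmt-QuantumFields-20203 S-BASE; design note `pub/ym-fleet/ym-luscher-20007-p1/COARSE-DESIGN.md` §8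
# brick (v), the β-UNIFORM floor `λ₀ ≥ c_L · c_β^{|E|}`)

One-link inputs of the β-uniform floor for the top zero-flux transfer value.  Everything is elementary given two facts already in the tree:
the lower half of the `t^{3/2}` law of the one-link window (Literature `SU2OneLink.le_haarProbability_real_two_sub_re_trace_le`:
`(8/3π³) t√t ≤ dW{2 − Re tr W ≤ t}`, `t ≤ 2`) and the Gaussian upper bound on the normaliser (`linkC_le_gauss`: `c_β ≤ e^{2β}√(π/β)³/(2π²)`).
* §1 `windowMass β r`, `0 ≤ m_β(r) ≤ c_β`, ★ `windowMass_ge`: `e^{2β} e^{−βr²/2} ballVol(r) ≤ m_β(r)` (`Re tr W = 2 − ‖W−1‖²_F/2`);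
* §2 ★ `ballVol_ge_threeHalves`: `(8/3π³)(r²/2)^{3/2} ≤ ballVol r` for `0 ≤ r ≤ 2`;
* §3 ★ `windowMass_ge_linkC`: `winConst a · c_β ≤ m_β(a/√β)` for `β ≥ 1`, `0 < a ≤ 1`, with the β-FREE constant
  `winConst a = e^{−1/2}·(16/(3π²√π))·(a²/2)^{3/2} > 0`;
* §4 halving: `ballVol r ≤ 5⁸ ballVol(r/2)` and its powers (the tree's doubling inequality).
HONEST FRAMING: one-link calculus; femto rung R2b1; not a gap, not infinite volume, not Clay.
-/

set_option autoImplicit false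

noncomputable section

open MeasureTheory Filter Topology Real
open scoped Matrix ComplexConjugate BigOperators Matrix.Norms.Frobenius
open Literature.MathematicalPhysics.QuantumFieldTheory
open Literature.MathematicalPhysics.QuantumLattice

namespace Summit.QuantumFields.YangMills.Theorems.FemtoTransferGap

/-! ## §1 The window mass -/

/-- **One-link window mass** `m_β(r) = ∫ 𝟙{‖W − 1‖_F ≤ r} e^{β Re tr W} dW`: the part of the one-link normaliser `c_β` carried by the
Hilbert–Schmidt ball of radius `r` about `1`. [cite: MontvayMunster1994, §3.2.3 (3.97) p.121] -/
def windowMass (β r : ℝ) : ℝ :=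
  ∫ W, {W : SU2 | frobNorm ((W : Matrix (Fin 2) (Fin 2) ℂ) - 1) ≤ r}.indicator (linkW β) W ∂haarProbability SU2

/-- The window integrand is measurable. [folklore] -/
theorem measurable_windowIntegrand (β r : ℝ) :
    Measurable ({W : SU2 | frobNorm ((W : Matrix (Fin 2) (Fin 2) ℂ) - 1) ≤ r}.indicator (linkW β)) :=
  (measurable_linkW β).indicator (measurableSet_frobBall_one r)

/-- The window integrand is between `0` and `w_β`. [folklore] -/
theorem windowIntegrand_nonneg (β r : ℝ) (W : SU2) :
    0 ≤ {W : SU2 | frobNorm ((W : Matrix (Fin 2) (Fin 2) ℂ) - 1) ≤ r}.indicator (linkW β) W :=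
  Set.indicator_nonneg (fun _ _ => (linkW_pos β _).le) _

/-- The window integrand is `≤ w_β`. [folklore] -/
theorem windowIntegrand_le (β r : ℝ) (W : SU2) :
    {W : SU2 | frobNorm ((W : Matrix (Fin 2) (Fin 2) ℂ) - 1) ≤ r}.indicator (linkW β) W ≤ linkW β W :=
  Set.indicator_le_self' (fun _ _ => (linkW_pos β _).le) _

/-- `|window integrand| ≤ e^{2β}` (`β ≥ 0`). [folklore] -/
theorem abs_windowIntegrand_le {β : ℝ} (hβ : 0 ≤ β) (r : ℝ) (W : SU2) :
    |{W : SU2 | frobNorm ((W : Matrix (Fin 2) (Fin 2) ℂ) - 1) ≤ r}.indicator (linkW β) W| ≤ Real.exp (2 * β) := by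
  rw [abs_of_nonneg (windowIntegrand_nonneg β r W)]
  exact (windowIntegrand_le β r W).trans (linkW_le hβ W)

/-- The window integrand is integrable (`β ≥ 0`). [folklore] -/
theorem integrable_windowIntegrand {β : ℝ} (hβ : 0 ≤ β) (r : ℝ) :
    Integrable ({W : SU2 | frobNorm ((W : Matrix (Fin 2) (Fin 2) ℂ) - 1) ≤ r}.indicator (linkW β)) (haarProbability SU2) :=
  integrable_of_measurable_abs_le _ (measurable_windowIntegrand β r) (abs_windowIntegrand_le hβ r)

/-- `0 ≤ m_β(r)`. [folklore] -/
theorem windowMass_nonneg (β r : ℝ) : 0 ≤ windowMass β r := integral_nonneg fun W => windowIntegrand_nonneg β r W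

/-- `m_β(r) ≤ c_β` (`β ≥ 0`). [folklore] -/
theorem windowMass_le_linkC {β : ℝ} (hβ : 0 ≤ β) (r : ℝ) : windowMass β r ≤ linkC β :=
  integral_mono (integrable_windowIntegrand hβ r) (integrable_linkW hβ) fun W => windowIntegrand_le β r W

/-- On the ball of radius `r` the one-link weight is `≥ e^{2β} e^{−βr²/2}` (`Re tr W = 2 − ‖W − 1‖²_F/2`, `β ≥ 0`). [folklore] -/
theorem linkW_ge_of_mem_ball {β : ℝ} (hβ : 0 ≤ β) {r : ℝ} {W : SU2} (hW : frobNorm ((W : Matrix (Fin 2) (Fin 2) ℂ) - 1) ≤ r) :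
    Real.exp (2 * β) * Real.exp (-(β * r ^ 2 / 2)) ≤ linkW β W := by
  unfold linkW
  rw [← Real.exp_add]
  refine Real.exp_le_exp.2 ?_
  have htr := two_sub_re_trace_eq W
  have h0 : 0 ≤ frobNorm ((W : Matrix (Fin 2) (Fin 2) ℂ) - 1) := frobNorm_nonneg _
  have hsq : frobNorm ((W : Matrix (Fin 2) (Fin 2) ℂ) - 1) ^ 2 ≤ r ^ 2 := pow_le_pow_left₀ h0 hW 2
  nlinarith

/-- ★ **`e^{2β} e^{−βr²/2} · ballVol(r) ≤ m_β(r)`** (`β ≥ 0`). [folklore] -/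
theorem windowMass_ge {β : ℝ} (hβ : 0 ≤ β) (r : ℝ) :
    Real.exp (2 * β) * Real.exp (-(β * r ^ 2 / 2)) * ballVol r ≤ windowMass β r := by
  set c : ℝ := Real.exp (2 * β) * Real.exp (-(β * r ^ 2 / 2)) with hc
  have hS := measurableSet_frobBall_one r
  have hlow : ∫ W, {W : SU2 | frobNorm ((W : Matrix (Fin 2) (Fin 2) ℂ) - 1) ≤ r}.indicator (fun _ => c) W ∂haarProbability SU2 =
      c * ballVol r := by
    rw [integral_indicator_const _ hS, smul_eq_mul, mul_comm]
    rfl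
  rw [← hlow]
  refine integral_mono ((integrable_const c).indicator hS) (integrable_windowIntegrand hβ r) fun W => ?_
  by_cases hW : W ∈ {W : SU2 | frobNorm ((W : Matrix (Fin 2) (Fin 2) ℂ) - 1) ≤ r}
  · rw [Set.indicator_of_mem hW, Set.indicator_of_mem hW]
    exact linkW_ge_of_mem_ball hβ hW
  · rw [Set.indicator_of_notMem hW, Set.indicator_of_notMem hW]

/-! ## §2 The `t^{3/2}` law in Hilbert–Schmidt radius -/

/-- The Hilbert–Schmidt ball of radius `r ≥ 0` is the trace window `{2 − Re tr W ≤ r²/2}`. [folklore] -/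
theorem frobBall_eq_traceWindow {r : ℝ} (hr : 0 ≤ r) :
    {W : SU2 | frobNorm ((W : Matrix (Fin 2) (Fin 2) ℂ) - 1) ≤ r} = {W : SU2 | 2 - ((W : Matrix (Fin 2) (Fin 2) ℂ).trace).re ≤ r ^ 2 / 2} := by
  ext W
  simp only [Set.mem_setOf_eq]
  rw [two_sub_re_trace_eq, div_le_div_iff_of_pos_right (by norm_num : (0 : ℝ) < 2),
    pow_le_pow_iff_left₀ (frobNorm_nonneg _) hr two_ne_zero]

/-- ★ **Lower `t^{3/2}` law**: `(8/3π³)·(r²/2)·√(r²/2) ≤ ballVol r` for `0 ≤ r ≤ 2`. [cite: MontvayMunster1994, §3.2.3 (3.97) p.121] -/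
theorem ballVol_ge_threeHalves {r : ℝ} (hr0 : 0 ≤ r) (hr : r ≤ 2) :
    8 / (3 * π ^ 3) * (r ^ 2 / 2 * Real.sqrt (r ^ 2 / 2)) ≤ ballVol r := by
  unfold ballVol
  rw [frobBall_eq_traceWindow hr0]
  have ht0 : 0 ≤ r ^ 2 / 2 := by positivity
  have ht : r ^ 2 / 2 ≤ 2 := by nlinarith
  exact SU2OneLink.le_haarProbability_real_two_sub_re_trace_le ht0 ht

/-! ## §3 The β-uniform window / normaliser ratio -/

/-- **Window constant** `winConst a = e^{−1/2} · (16/(3π²√π)) · (a²/2)·√(a²/2)` — the β-free lower bound for `m_β(a/√β)/c_β`. [folklore] -/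
def winConst (a : ℝ) : ℝ := Real.exp (-(1 / 2 : ℝ)) * (16 / (3 * π ^ 2 * Real.sqrt π)) * (a ^ 2 / 2 * Real.sqrt (a ^ 2 / 2))

/-- `0 < winConst a` for `a > 0`. [folklore] -/
theorem winConst_pos {a : ℝ} (ha : 0 < a) : 0 < winConst a := by
  unfold winConst
  have hπ := Real.pi_pos
  have h1 : 0 < Real.sqrt π := Real.sqrt_pos.2 hπ
  have h2 : 0 < Real.sqrt (a ^ 2 / 2) := Real.sqrt_pos.2 (by positivity)
  positivity

/-- `0 ≤ winConst a`. [folklore] -/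
theorem winConst_nonneg (a : ℝ) : 0 ≤ winConst a := by
  unfold winConst
  have h1 : 0 ≤ Real.sqrt π := Real.sqrt_nonneg _
  have h2 : 0 ≤ Real.sqrt (a ^ 2 / 2) := Real.sqrt_nonneg _
  positivity

/-- `√x³ = x·√x` (`x ≥ 0`). [folklore] -/
theorem sqrt_pow_three {x : ℝ} (hx : 0 ≤ x) : Real.sqrt x ^ 3 = x * Real.sqrt x := by
  rw [pow_succ, Real.sq_sqrt hx]

/-- ★★ **β-uniform window / normaliser ratio**: `winConst a · c_β ≤ m_β(a/√β)` for `β ≥ 1` and `0 < a ≤ 1` — at the natural radius `a/√β` the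
window carries a β-INDEPENDENT fraction of the one-link normaliser. [cite: MontvayMunster1994, §3.2.3 (3.97) p.121] -/
theorem windowMass_ge_linkC {β : ℝ} (hβ : 1 ≤ β) {a : ℝ} (ha0 : 0 < a) (ha : a ≤ 1) :
    winConst a * linkC β ≤ windowMass β (a / Real.sqrt β) := by
  have hβ0 : 0 < β := by linarith
  have hπ := Real.pi_pos
  have hsπ : 0 < Real.sqrt π := Real.sqrt_pos.2 hπ
  have hsβ : 0 < Real.sqrt β := Real.sqrt_pos.2 hβ0
  have hsβ1 : 1 ≤ Real.sqrt β := by rw [← Real.sqrt_one]; exact Real.sqrt_le_sqrt hβ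
  set X : ℝ := Real.exp (2 * β) / (β * Real.sqrt β) with hX
  have hX0 : 0 < X := by positivity
  set m : ℝ := a ^ 2 / 2 * Real.sqrt (a ^ 2 / 2) with hm
  have hm0 : 0 ≤ m := by positivity
  -- (i) the window mass from below
  have hr0 : 0 ≤ a / Real.sqrt β := by positivity
  have hr2 : a / Real.sqrt β ≤ 2 := by
    rw [div_le_iff₀ hsβ]; nlinarith
  have hrsq : (a / Real.sqrt β) ^ 2 / 2 = (a ^ 2 / 2) / β := by
    rw [div_pow, Real.sq_sqrt hβ0.le]; ring
  have hball := ballVol_ge_threeHalves hr0 hr2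
  rw [hrsq, Real.sqrt_div (by positivity : (0 : ℝ) ≤ a ^ 2 / 2) β] at hball
  have hball' : 8 / (3 * π ^ 3) * m / (β * Real.sqrt β) ≤ ballVol (a / Real.sqrt β) := by
    have e : 8 / (3 * π ^ 3) * m / (β * Real.sqrt β) = 8 / (3 * π ^ 3) * (a ^ 2 / 2 / β * (Real.sqrt (a ^ 2 / 2) / Real.sqrt β)) := by
      rw [hm]; field_simp
    rw [e]; exact hball
  have hexp : Real.exp (-(1 / 2 : ℝ)) ≤ Real.exp (-(β * (a / Real.sqrt β) ^ 2 / 2)) := by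
    refine Real.exp_le_exp.2 ?_
    have h1 : β * (a / Real.sqrt β) ^ 2 / 2 = a ^ 2 / 2 := by rw [div_pow, Real.sq_sqrt hβ0.le]; field_simp
    rw [h1]; nlinarith
  have hwin := windowMass_ge hβ0.le (a / Real.sqrt β)
  have hi : Real.exp (-(1 / 2 : ℝ)) * (8 / (3 * π ^ 3)) * m * X ≤ windowMass β (a / Real.sqrt β) := by
    refine le_trans ?_ hwin
    have e : Real.exp (-(1 / 2 : ℝ)) * (8 / (3 * π ^ 3)) * m * X =
        Real.exp (2 * β) * Real.exp (-(1 / 2 : ℝ)) * (8 / (3 * π ^ 3) * m / (β * Real.sqrt β)) := by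
      rw [hX]; field_simp
    rw [e]
    exact mul_le_mul (mul_le_mul_of_nonneg_left hexp (Real.exp_pos _).le) hball' (by positivity) (by positivity)
  -- (ii) the normaliser from above
  have hii : linkC β ≤ π * Real.sqrt π / (2 * π ^ 2) * X := by
    have h := linkC_le_gauss hβ0
    have e : Real.sqrt (π / β) ^ 3 = π * Real.sqrt π / (β * Real.sqrt β) := by
      rw [Real.sqrt_div hπ.le β, div_pow, sqrt_pow_three hπ.le, sqrt_pow_three hβ0.le]
    rw [e] at h
    have e2 : π * Real.sqrt π / (2 * π ^ 2) * X = Real.exp (2 * β) * (π * Real.sqrt π / (β * Real.sqrt β)) / (2 * π ^ 2) := by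
      rw [hX]; field_simp
    rw [e2]; exact h
  -- (iii) the constant
  have hkey : winConst a * (π * Real.sqrt π / (2 * π ^ 2)) = Real.exp (-(1 / 2 : ℝ)) * (8 / (3 * π ^ 3)) * m := by
    rw [winConst, ← hm]
    field_simp
    ring
  calc winConst a * linkC β ≤ winConst a * (π * Real.sqrt π / (2 * π ^ 2) * X) := mul_le_mul_of_nonneg_left hii (winConst_nonneg a)
    _ = Real.exp (-(1 / 2 : ℝ)) * (8 / (3 * π ^ 3)) * m * X := by rw [← mul_assoc, hkey]
    _ ≤ windowMass β (a / Real.sqrt β) := hi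

/-! ## §4 Halving the radius costs a β-free factor -/

/-- `ballVol r ≤ 5⁸ · ballVol (r/2)` (`r ≥ 0`; the tree's doubling inequality at radius `r/2`). [folklore] -/
theorem ballVol_le_half {r : ℝ} (hr : 0 ≤ r) : ballVol r ≤ 5 ^ 8 * ballVol (r / 2) := by
  have h := ballVol_two_mul_le (r := r / 2) (by positivity)
  rwa [show 2 * (r / 2) = r by ring] at h

/-- Powers: `ballVol(r)^N ≤ (5⁸)^N · ballVol(r/2)^N` (`r ≥ 0`). [folklore] -/
theorem ballVol_pow_le_half {r : ℝ} (hr : 0 ≤ r) (N : ℕ) : ballVol r ^ N ≤ ((5 : ℝ) ^ 8) ^ N * ballVol (r / 2) ^ N := by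
  rw [← mul_pow]
  exact pow_le_pow_left₀ (ballVol_nonneg r) (ballVol_le_half hr) N

end Summit.QuantumFields.YangMills.Theorems.FemtoTransferGap

end
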